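import Summits.BirchSwinnertonDyer.BirchSwinnertonDyer.Theorems.Rank1ResidualIntModelReduction
import HarnessLib

/-!
# Route `KatoDescentTamePotSupersingular` (rung K8, sub-rung B4 (t′), cell `bsd-potss`): a kernel TOOL for the per-row unit-twist records —
# `ord_p j(E) ≥ 0` (potentially good reduction) read off the integer model (seat `bsd-potss-k8t-c4` g14; route-free; 0 definitions,
# 0 named facts, 0 `sorry`; closes nothing)

WHY. The ♯ unit-twist road (`TameUpperUnitTwistRecords.missingUpperBoundAt_sharp_of_namedFacts_of_datum_of_unitTwist`) takes
`hj : 0 ≤ padicValRat p W.j` (the row is potentially GOOD at `p`). For a literal globally minimal model this is the arithmetic fact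
`3·ord_p c₄ ≥ ord_p Δ`, which the kernel can check by divisibilities of the integer invariants: `padicValRat_j_nonneg_of_intModel`.

References: [SilvermanAEC2009] VII.5 Prop. 5.5 (potential good reduction iff `j` integral at `v`), III.1 (the invariants `c₄`, `Δ`, `j`).
-/

set_option autoImplicit false
-- the Theorems directory repeats the summit name (sibling precedent `KatoDescentPotSupersingularAssembly.lean`)
set_option linter.dupNamespace false

noncomputable section

open scoped Classical

namespace Summit.BirchSwinnertonDyer.BirchSwinnertonDyer.Theorems.TameUpperUnitTwistRecords

open WeierstrassCurve Summit.BirchSwinnertonDyer.BirchSwinnertonDyer.Rank1Residual.IntModel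
  Literature.NumberTheory.EllipticCurves

/-- **`ord_p j(W) ≥ 0` from the integer model.** For a globally minimal `W/ℚ` with integer model `E₀`, if `pᵃ ∣ c₄(E₀)` and
`p^{b+1} ∤ Δ(E₀)` with `b ≤ 3a`, then `ord_p j(W) = 3·ord_p c₄ − ord_p Δ ≥ 3a − b ≥ 0` (and `j = 0` when `c₄ = 0`): the curve is
potentially good at `p` (Silverman VII.5.5). Kernel-checkable hypotheses for the per-row records. [cite: SilvermanAEC2009, VII.5 Prop. 5.5 and III.1] -/
theorem padicValRat_j_nonneg_of_intModel {W : WeierstrassCurve ℚ} [W.IsElliptic] [W.IsGloballyMinimal]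
    {E₀ : WeierstrassCurve ℤ} (hI : integralModelInt W = E₀) (p : ℕ) [hp : Fact p.Prime]
    {a b : ℕ} (ha : (p : ℤ) ^ a ∣ E₀.c₄) (hb : ¬ (p : ℤ) ^ (b + 1) ∣ E₀.Δ) (h3 : b ≤ 3 * a) :
    0 ≤ padicValRat p W.j := by
  have hΔW : W.Δ ≠ 0 := by rw [← W.coe_Δ']; exact W.Δ'.ne_zero
  have hΔ0 : E₀.Δ ≠ 0 := by
    intro h
    apply hΔW
    rw [Δ_eq_cast hI, h, Int.cast_zero]
  have hj : W.j = ((E₀.c₄ : ℚ)) ^ 3 / (E₀.Δ : ℚ) := by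
    rw [WeierstrassCurve.j, Units.val_inv_eq_inv_val, W.coe_Δ', ← c₄_eq_cast hI, ← Δ_eq_cast hI, div_eq_inv_mul]
  by_cases hc0 : E₀.c₄ = 0
  · rw [hj, hc0]
    simp
  have hvΔ : padicValInt p E₀.Δ ≤ b := by
    by_contra hlt
    exact hb ((padicValInt_dvd_iff (b + 1) E₀.Δ).mpr (Or.inr (by omega)))
  have hvc : a ≤ padicValInt p E₀.c₄ := ((padicValInt_dvd_iff a E₀.c₄).mp ha).resolve_left hc0
  have hc0' : ((E₀.c₄ : ℚ)) ^ 3 ≠ 0 := pow_ne_zero 3 (by exact_mod_cast hc0)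
  have hΔ0' : (E₀.Δ : ℚ) ≠ 0 := by exact_mod_cast hΔ0
  rw [hj, padicValRat.div hc0' hΔ0', padicValRat.pow, padicValRat.of_int, padicValRat.of_int]
  push_cast
  omega

end Summit.BirchSwinnertonDyer.BirchSwinnertonDyer.Theorems.TameUpperUnitTwistRecords
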